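import Summits.QuantumFields.BalabanUV.T4Continuum.Spine.NE9.DirectPairingApexAnalyticScheme

/-!
# T⁴ programme, spine estimate NE9 — THE RATE AT THE APEX: THE CUMULANT-GENERATING-FUNCTION CURRENCY GAINS EXACTLY A `log log` — the three lines on a
# GROWING ellipse with the global growth of Laplace transforms; the scheme's apex rate improved to `η·log η⁻¹∕log log η⁻¹` — census item C46 (c) of cell
# `pub-balaban-gaps`, seat ne9 (gen 15)

Cell `pub-balaban-gaps` (YM blitz G2, seat ne9, unit `pub-balaban-gaps-ne9-g15`; record `run/shared/lean/pub/pub-balaban-gaps/ne/NE9.md` §5 row C46).  Sequel to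
`DirectPairingApexAnalyticSharp` (C46 (a): in the MODEL currency — holomorphy near `[−l, l]`, a bound `M` on a FIXED ellipse, `η` on the segment — the apex
logarithm `η·log(M∕η)` is necessary, Chebyshev witness) and `DirectPairingApexCGFSharp(Laws)` (C46 (b): in the CGF currency — differences of cumulant generating
functions of observables bounded by `1` — Müntz–Chebyshev laws show a loss `≳ N ≍ log η⁻¹∕log log η⁻¹`, so no constant loss factor).  THIS FILE closes the gap
between the two: the CGF currency carries MORE than the MODEL hypotheses — the difference `G = M′ − M` of the two moment generating functions is ENTIRE with the
global growth `‖G(z)‖ ≤ 2·e^{‖z‖}` (Laplace transforms of laws on `[−1, 1]`) — and Hadamard's three lines on an ellipse whose size GROWS like `log log η⁻¹`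
(the landed `DirectPairingApexAnalytic.norm_deriv_le_log`, applied with `M = A·e^{l·e^{Y}}`, `Y = log log(A∕η)`) give
`‖G′(0)‖ ≤ e·(l+1)·η·log(A∕η)∕(l·log log(A∕η))` (`norm_deriv_le_loglog`).  Consequences: (i) for two laws on finitely many nodes of `[−1, 1]` whose cgf's are
`η`-close on `[−l, l]` the means differ by at most `C_l·η·log η⁻¹∕log log η⁻¹` (`cgf_mean_sub_le_loglog`) — with C46 (b)'s witness `≥ N·η∕(3l)`,
`N ≍ log η⁻¹∕log log η⁻¹`, the apex loss in the CGF currency is EXACTLY `Θ(log η⁻¹∕log log η⁻¹)`: positivity gains precisely a `log log` over the MODEL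
currency, no more; (ii) for the T⁴ scheme under King's per-string socket (the datum of `DirectPairingApex.stringwiseGenFunCauchy_of_king`, verbatim the
hypotheses of `DirectPairingApexAnalyticScheme.expectAt_rate_of_king_analytic`): **`expectAt_rate_of_king_analytic_loglog`** —
`∣⟨∏W⟩_{K₀+K} − E∣ ≤ e·(l₀+1)·η_K·log(2∕η_K)∕(l₀·log log(2∕η_K))`, `η_K = 4e^{l₀}·vol·Δ_K`, on the FULL window `l₀` (no `1∕5` cap, no logarithm of `complexMGF`:
the entire difference `complexMGF_{K₀+K+n} − complexMGF_{K₀+K}` replaces `log ∘ complexMGF`; its real restriction is `e^{genFun′} − e^{genFun}`, `η_K`-small by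
the socket and `e^{−∣t∣} ≤ Z_K(t)∕Z_K(0) ≤ e^{∣t∣}`; its growth is `2e^{‖z‖}` by `T4GenFunBounds.norm_complexMGF_scheme_le`).
* §1 `norm_deriv_le_of_growth` (every level `Y`), `norm_deriv_le_loglog` (the level `Y = log log(A∕η)`).
* §2 `cgf_mean_sub_le_loglog` (finite laws: the upper bound matching `DirectPairingApexCGFSharpLaws.cgf_log_loss_witness` up to constants).
* §3 `expectAt_rate_of_king_analytic_loglog` (the scheme).

HONEST FRAMING: MODEL-level complex ∕ real analysis on hypothesis SHAPES (label MODEL) for rung (B)+1 bookkeeping on ONE FIXED finite four-torus; NO definition;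
§3 is a CONDITIONAL kernel theorem on King's matching SHAPE — the cell's located estimate, NOT in print for Bałaban's d = 4 procedure; every bound is a MODEL
formula, not a certified constant of Bałaban's; NOTHING new is owed by the E-side; CLASSIFICATION OF NE9 UNCHANGED: WORK-bound (W1 = the one-step renormalization
transformation as a Lean object; instance 0∕1); NE9 NOT PRINTED ∕ NOT PROVED; spine PROVED 0∕9 unchanged; NOT UV stability, NOT the continuum limit, NOT
infinite volume, NOT a mass gap, NOT Clay.  DEPENDENCY: continuum YM on T⁴ ⇐ BetaPertH ∧ nine spine estimates (0∕9 proved).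

References (TYPES only): [King1986] = C. King, Commun. Math. Phys. **102** (1986) 649–677, Thm 3.4 (3.9) p. 656, p. 657 (the socket's shape, d = 3); the
two-constants ∕ three-lines device is classical; Mathlib's `Complex.HadamardThreeLines` (through the landed `norm_deriv_le_log`), `Real.abs_exp_sub_one_le`,
the tree's `T4GenFunBounds.norm_complexMGF_scheme_le` ∕ `complexMGF_scheme_ofReal` ∕ `deriv_complexMGF_scheme_zero` ∕ `schemeZ_div_mem_Icc` and
`DirectPairingCauchy.abs_genFun_add_sub_le` consumed BY NAME.
-/

namespace Summit.QuantumFields.BalabanUV.T4Continuum.NE9.DirectPairingApexCGFRate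

open Complex Set Filter Topology MeasureTheory ProbabilityTheory Metric Finset
open Literature.MathematicalPhysics.QuantumFieldTheory.Balaban1983to89
open T4CauchySum (genFun)
open Missing (TorusScheme)
open Summit.QuantumFields.BalabanUV.T4Continuum.NE9.DirectPairingCauchy (abs_genFun_add_sub_le)
open Summit.QuantumFields.BalabanUV.T4Continuum.NE9.DirectPairingApexAnalytic
  (norm_deriv_le_log limit_le_of_pairBound')

/-! ## §1 Three lines on a growing ellipse: the `log log` gain from global exponential growth -/

section Growth

variable {G : ℂ → ℂ} {A l η : ℝ}

/-- **EVERY LEVEL `Y`.**  `G` entire with global growth `‖G(w)‖ ≤ A·e^{‖w‖}` and `‖G(x)‖ ≤ η` on the real segment `[−l, l]` (`0 < l`, `0 < η`, `e·η ≤ A`): for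
every `Y > 0`, `‖G′(0)‖ ≤ e·η·(l·e^{Y} + log(A∕η))∕(l·Y)` — the landed `norm_deriv_le_log` on the filled ellipse `{l·cos z : ∣Im z∣ ≤ Y}` (inside `‖w‖ ≤ l·e^{Y}`)
with `M = A·e^{l·e^{Y}}`.  MODEL-level. [folklore] -/
theorem norm_deriv_le_of_growth (hG : Differentiable ℂ G) (hA : ∀ w : ℂ, ‖G w‖ ≤ A * Real.exp ‖w‖)
    (hη : ∀ x : ℝ, |x| ≤ l → ‖G x‖ ≤ η) (hl : 0 < l) (hη0 : 0 < η) (hηA : Real.exp 1 * η ≤ A) {Y : ℝ} (hY : 0 < Y) :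
    ‖deriv G 0‖ ≤ Real.exp 1 * η * (l * Real.exp Y + Real.log (A / η)) / (l * Y) := by
  set M : ℝ := A * Real.exp (l * Real.exp Y) with hM
  have hApos : 0 < A := lt_of_lt_of_le (by positivity) hηA
  -- `‖cos z‖ ≤ e^{∣Im z∣}` (re-derived inline; the tree has it under topic-foreign modules)
  have hcos : ∀ z : ℂ, ‖Complex.cos z‖ ≤ Real.exp |z.im| := fun z => by
    have h := norm_add_le (Complex.exp (z * I)) (Complex.exp (-z * I))
    rw [← Complex.two_cos, norm_mul, Complex.norm_two, Complex.norm_exp, Complex.norm_exp] at h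
    have e1 : (z * I).re = -z.im := by simp
    have e2 : (-z * I).re = z.im := by simp
    rw [e1, e2] at h
    have h1 : Real.exp (-z.im) ≤ Real.exp |z.im| := Real.exp_le_exp.mpr (neg_le_abs _)
    have h2 : Real.exp z.im ≤ Real.exp |z.im| := Real.exp_le_exp.mpr (le_abs_self _)
    linarith
  have hMb : ∀ z : ℂ, |z.im| ≤ Y → ‖G ((l : ℂ) * Complex.cos z)‖ ≤ M := by
    intro z hz
    refine (hA _).trans ?_
    rw [hM]
    refine mul_le_mul_of_nonneg_left (Real.exp_le_exp.mpr ?_) hApos.le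
    rw [norm_mul, Complex.norm_real, Real.norm_eq_abs, abs_of_pos hl]
    exact mul_le_mul_of_nonneg_left ((hcos z).trans (Real.exp_le_exp.mpr hz)) hl.le
  have hηb : ∀ x : ℝ, ‖G ((l : ℂ) * Complex.cos x)‖ ≤ η := by
    intro x
    have e : (l : ℂ) * Complex.cos x = ((l * Real.cos x : ℝ) : ℂ) := by rw [Complex.ofReal_mul, Complex.ofReal_cos]
    rw [e]
    refine hη _ ?_
    rw [abs_mul, abs_of_pos hl]
    nlinarith [Real.abs_cos_le_one x, abs_nonneg (Real.cos x)]
  have hηM : Real.exp 1 * η ≤ M := by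
    rw [hM]
    have : A ≤ A * Real.exp (l * Real.exp Y) := le_mul_of_one_le_right hApos.le (Real.one_le_exp (by positivity))
    linarith
  have key := norm_deriv_le_log (U := univ) isOpen_univ hG.differentiableOn hl hY (fun z _ => mem_univ _) hMb hηb hη0 hηM
  have hlog : Real.log (M / η) = l * Real.exp Y + Real.log (A / η) := by
    rw [hM, mul_div_right_comm, Real.log_mul (div_pos hApos hη0).ne' (Real.exp_pos _).ne', Real.log_exp, add_comm]
  rwa [hlog] at key

/-- **THE `log log` GAIN.**  Under the same hypotheses with `e^{e}·η ≤ A` (so `log(A∕η) ≥ e`), at the level `Y = log log(A∕η)`: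
`‖G′(0)‖ ≤ e·(l+1)·η·log(A∕η)∕(l·log log(A∕η))`.  For Laplace transforms of signed measures of mass `≤ A` on `[−1, 1]` this is the CGF-currency upper bound
matching the Müntz–Chebyshev lower bound of `DirectPairingApexCGFSharpLaws` up to constants.  MODEL-level. [folklore] -/
theorem norm_deriv_le_loglog (hG : Differentiable ℂ G) (hA : ∀ w : ℂ, ‖G w‖ ≤ A * Real.exp ‖w‖)
    (hη : ∀ x : ℝ, |x| ≤ l → ‖G x‖ ≤ η) (hl : 0 < l) (hη0 : 0 < η) (hηA : Real.exp (Real.exp 1) * η ≤ A) :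
    ‖deriv G 0‖ ≤ Real.exp 1 * (l + 1) * η * Real.log (A / η) / (l * Real.log (Real.log (A / η))) := by
  have hApos : 0 < A := lt_of_lt_of_le (by positivity) hηA
  set L : ℝ := Real.log (A / η) with hL
  have hLe : Real.exp 1 ≤ L := by
    rw [hL, ← Real.log_exp (Real.exp 1)]
    exact Real.log_le_log (Real.exp_pos _) (by rw [le_div_iff₀ hη0]; exact hηA)
  have hLpos : 0 < L := lt_of_lt_of_le (Real.exp_pos 1) hLe
  have hY : 0 < Real.log L := Real.log_pos (lt_of_lt_of_le (by linarith [Real.add_one_le_exp (1 : ℝ)]) hLe)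
  have hηA' : Real.exp 1 * η ≤ A := by
    have : Real.exp 1 ≤ Real.exp (Real.exp 1) := Real.exp_le_exp.mpr (by linarith [Real.add_one_le_exp (1 : ℝ)])
    nlinarith
  have h1 := norm_deriv_le_of_growth hG hA hη hl hη0 hηA' hY
  rw [Real.exp_log hLpos, ← hL] at h1
  refine h1.trans (le_of_eq ?_)
  congr 1
  ring

end Growth

/-! ## §2 Finite laws on `[−1, 1]`: the upper bound matching C46 (b)'s Müntz–Chebyshev witness -/

section Laws

/-- **CGF CURRENCY, FINITE LAWS — THE UPPER BOUND.**  `p, p′` positive weights of total mass `1` on nodes `x_k ∈ [−1, 1]` (`k < n`); if their cumulant generating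
functions are `η`-close on `∣t∣ ≤ l` (`0 < l`, `0 < η ≤ 1`) then, with `η′ = 2e^{l}·η` and provided `e^{e}·η′ ≤ 2`, the means differ by at most
`e·(l+1)·η′·log(2∕η′)∕(l·log log(2∕η′))`: the entire function `G(z) = Σ (p′_k − p_k)e^{z x_k}` has growth `2e^{‖z‖}`, real restriction `M_p·(e^{Δcgf} − 1)`,
`∣·∣ ≤ η′` on the window, and `G′(0) = Σ (p′_k − p_k)x_k`.  Together with `DirectPairingApexCGFSharpLaws.cgf_log_loss_witness` (means `≥ N·η∕(3l)` apart,
`N ≍ log η⁻¹∕log log η⁻¹`): the loss in the CGF currency is `Θ(log η⁻¹∕log log η⁻¹)`.  MODEL-level. [folklore] -/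
theorem cgf_mean_sub_le_loglog {p p' x : ℕ → ℝ} {n : ℕ} {l η : ℝ} (hl : 0 < l) (hη0 : 0 < η) (hη1 : η ≤ 1)
    (hx : ∀ k ∈ range n, |x k| ≤ 1) (hp : ∀ k ∈ range n, 0 < p k) (hp' : ∀ k ∈ range n, 0 < p' k)
    (hs : ∑ k ∈ range n, p k = 1) (hs' : ∑ k ∈ range n, p' k = 1)
    (hclose : ∀ t : ℝ, |t| ≤ l →
      |Real.log (∑ k ∈ range n, p' k * Real.exp (t * x k)) - Real.log (∑ k ∈ range n, p k * Real.exp (t * x k))| ≤ η)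
    (hsmall : Real.exp (Real.exp 1) * (2 * Real.exp l * η) ≤ 2) :
    |∑ k ∈ range n, (p' k - p k) * x k| ≤
      Real.exp 1 * (l + 1) * (2 * Real.exp l * η) * Real.log (2 / (2 * Real.exp l * η)) /
        (l * Real.log (Real.log (2 / (2 * Real.exp l * η)))) := by
  -- the entire function `G`
  set G : ℂ → ℂ := fun z => ∑ k ∈ range n, ((p' k - p k : ℝ) : ℂ) * Complex.exp (z * (x k : ℂ)) with hG
  have hGd : Differentiable ℂ G := by
    refine Differentiable.fun_sum fun k _ => ?_
    fun_prop
  -- growth `‖G z‖ ≤ 2 e^{‖z‖}`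
  have hA : ∀ w : ℂ, ‖G w‖ ≤ 2 * Real.exp ‖w‖ := by
    intro w
    have hterm : ∀ k ∈ range n, ‖((p' k - p k : ℝ) : ℂ) * Complex.exp (w * (x k : ℂ))‖ ≤ (p' k + p k) * Real.exp ‖w‖ := by
      intro k hk
      rw [norm_mul, Complex.norm_real, Complex.norm_exp, Real.norm_eq_abs]
      have h1 : |p' k - p k| ≤ p' k + p k := by
        rw [abs_le]; constructor <;> linarith [hp k hk, hp' k hk]
      have h2 : (w * (x k : ℂ)).re ≤ ‖w‖ := by
        have := Complex.re_le_norm (w * (x k : ℂ))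
        rw [norm_mul, Complex.norm_real, Real.norm_eq_abs] at this
        nlinarith [hx k hk, norm_nonneg w, abs_nonneg (x k)]
      exact mul_le_mul h1 (Real.exp_le_exp.mpr h2) (Real.exp_pos _).le (by linarith [hp k hk, hp' k hk])
    calc ‖G w‖ ≤ ∑ k ∈ range n, ‖((p' k - p k : ℝ) : ℂ) * Complex.exp (w * (x k : ℂ))‖ := norm_sum_le _ _
      _ ≤ ∑ k ∈ range n, (p' k + p k) * Real.exp ‖w‖ := sum_le_sum hterm
      _ = 2 * Real.exp ‖w‖ := by rw [← sum_mul, sum_add_distrib, hs, hs']; ring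
  -- real restriction: `G t = M′(t) − M(t)`, `∣·∣ ≤ 2 e^{l} η`
  have hMpos : ∀ t : ℝ, 0 < ∑ k ∈ range n, p k * Real.exp (t * x k) := by
    intro t
    have hne : (range n).Nonempty := by
      rw [nonempty_range_iff]; rintro rfl; simp at hs
    exact sum_pos (fun k hk => mul_pos (hp k hk) (Real.exp_pos _)) hne
  have hMle : ∀ t : ℝ, |t| ≤ l → ∑ k ∈ range n, p k * Real.exp (t * x k) ≤ Real.exp l := by
    intro t ht
    have hterm : ∀ k ∈ range n, p k * Real.exp (t * x k) ≤ p k * Real.exp l := by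
      intro k hk
      refine mul_le_mul_of_nonneg_left (Real.exp_le_exp.mpr ?_) (hp k hk).le
      have := abs_mul t (x k)
      have h2 : |t| * |x k| ≤ l * 1 := mul_le_mul ht (hx k hk) (abs_nonneg _) hl.le
      linarith [le_abs_self (t * x k)]
    calc ∑ k ∈ range n, p k * Real.exp (t * x k) ≤ ∑ k ∈ range n, p k * Real.exp l := sum_le_sum hterm
      _ = Real.exp l := by rw [← sum_mul, hs, one_mul]
  have hGreal : ∀ t : ℝ, G t = (((∑ k ∈ range n, p' k * Real.exp (t * x k)) - ∑ k ∈ range n, p k * Real.exp (t * x k) : ℝ) : ℂ) := by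
    intro t
    rw [hG]
    push_cast
    rw [← sum_sub_distrib]
    refine sum_congr rfl fun k _ => ?_
    ring
  have hηb : ∀ t : ℝ, |t| ≤ l → ‖G t‖ ≤ 2 * Real.exp l * η := by
    intro t ht
    set M := ∑ k ∈ range n, p k * Real.exp (t * x k) with hMdef
    set M' := ∑ k ∈ range n, p' k * Real.exp (t * x k) with hM'def
    have hM : 0 < M := hMpos t
    have hM'pos : 0 < M' := by
      have hne : (range n).Nonempty := by
        rw [nonempty_range_iff]; rintro rfl; simp at hs
      exact sum_pos (fun k hk => mul_pos (hp' k hk) (Real.exp_pos _)) hne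
    have hD := hclose t ht
    rw [← hM'def, ← hMdef] at hD
    -- `M′ − M = M (e^{D} − 1)`, `D = log M′ − log M`
    have hrat : M' - M = M * (Real.exp (Real.log M' - Real.log M) - 1) := by
      rw [Real.exp_sub, Real.exp_log hM'pos, Real.exp_log hM, mul_sub, mul_one, mul_div_assoc', mul_div_cancel_left₀ _ hM.ne']
    have hexp : |Real.exp (Real.log M' - Real.log M) - 1| ≤ 2 * |Real.log M' - Real.log M| :=
      Real.abs_exp_sub_one_le (hD.trans hη1)
    rw [hGreal t, Complex.norm_real, Real.norm_eq_abs, ← hM'def, ← hMdef, hrat, abs_mul, abs_of_pos hM]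
    calc M * |Real.exp (Real.log M' - Real.log M) - 1| ≤ Real.exp l * (2 * η) :=
          mul_le_mul (hMle t ht) (hexp.trans (by linarith)) (abs_nonneg _) (Real.exp_pos _).le
      _ = 2 * Real.exp l * η := by ring
  -- derivative at `0`
  have hderiv : deriv G 0 = ((∑ k ∈ range n, (p' k - p k) * x k : ℝ) : ℂ) := by
    have h : ∀ k ∈ range n, HasDerivAt (fun z : ℂ => ((p' k - p k : ℝ) : ℂ) * Complex.exp (z * (x k : ℂ)))
        (((p' k - p k : ℝ) : ℂ) * (x k : ℂ)) 0 := by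
      intro k _
      have h1 : HasDerivAt (fun z : ℂ => Complex.exp (z * (x k : ℂ))) (Complex.exp (0 * (x k : ℂ)) * (1 * (x k : ℂ))) 0 :=
        ((hasDerivAt_id (0 : ℂ)).mul_const (x k : ℂ)).cexp
      rw [zero_mul, Complex.exp_zero, one_mul, one_mul] at h1
      exact h1.const_mul _
    rw [(HasDerivAt.fun_sum h).deriv]
    push_cast
    rfl
  have hη0' : 0 < 2 * Real.exp l * η := by positivity
  have key := norm_deriv_le_loglog hGd hA hηb hl hη0' hsmall
  rwa [hderiv, Complex.norm_real, Real.norm_eq_abs] at key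

end Laws

/-! ## §3 The scheme: the apex rate on the King route, improved by the `log log` -/

section Scheme

variable {G : Type*} [GaugeGroup G] [MeasurableSpace G] [RegularGaugeGroup G] [HaarData G] {O : Type*}

/-- **THE RATE AT THE APEX, CGF CURRENCY: `∣⟨∏W⟩_{K₀+K} − E∣ ≤ e·(l₀+1)·η_K·log(2∕η_K)∕(l₀·log log(2∕η_K))`, `η_K = 4e^{l₀}·vol·Δ_K`.**  Hypotheses VERBATIM
those of `DirectPairingApexAnalyticScheme.expectAt_rate_of_king_analytic` (a scheme with `β_K ≥ 0`, measurable observables bounded by `1`, ONE string with King's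
socket `∣log Z_{K₀+K+n}(t) − log Z_{K₀+K}(t) − c∣ ≤ vol·Δ_K` on `∣t∣ ≤ l₀`, `Δ_K → 0`).  Proof: the entire difference `complexMGF_{K₀+K+n} − complexMGF_{K₀+K}` of the
product observables' moment generating functions has growth `2e^{‖z‖}` (`T4GenFunBounds.norm_complexMGF_scheme_le`), real restriction
`Z′(t)∕Z′(0) − Z(t)∕Z(0) = (Z(t)∕Z(0))·(e^{ΔgenFun(t)} − 1)` of size `≤ e^{l₀}·2·(2vol·Δ_K)` on the window (`DirectPairingCauchy.abs_genFun_add_sub_le`,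
`T4GenFunBounds.schemeZ_div_mem_Icc`, `Real.abs_exp_sub_one_le`), and derivative at `0` the difference of the expectations
(`T4GenFunBounds.deriv_complexMGF_scheme_zero`); §1 on the growing ellipse; the limit `E` from `expectAt_rate_of_king_analytic`.  The gain over
`expectAt_rate_of_king_analytic_log` is the `log log` (and the full window `l₀`); by C46 (b) nothing better holds in this currency.  CONDITIONAL kernel theorem on
a hypothesis SHAPE (King's matching). [cite: King1986, Thm 3.4 (3.9) p. 656, p. 657] [folklore] -/
theorem expectAt_rate_of_king_analytic_loglog (S : TorusScheme G O) (hβ : ∀ K, 0 ≤ S.β K)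
    (hm : ∀ K o, Measurable (S.obs K o)) (h1 : ∀ K o U, |S.obs K o U| ≤ 1) (os : List O)
    {l₀ vol : ℝ} {K₀ : ℕ} {Δ : ℕ → ℝ} (hl₀ : 0 < l₀) (hΔ : Tendsto Δ atTop (𝓝 0))
    (hU5 : ∀ K n : ℕ, ∃ c : ℝ, ∀ t : ℝ, |t| ≤ l₀ →
      |Real.log (T4GenFunBounds.schemeZ S os (K₀ + (K + n)) t) -
          Real.log (T4GenFunBounds.schemeZ S os (K₀ + K) t) - c| ≤ vol * Δ K) :
    ∃ E : ℝ, Tendsto (fun K => S.expectAt K os) atTop (𝓝 E) ∧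
      ∀ K, 0 < vol * Δ K → 2 * (vol * Δ K) ≤ 1 → Real.exp (Real.exp 1) * (4 * Real.exp l₀ * (vol * Δ K)) ≤ 2 →
        |S.expectAt (K₀ + K) os - E| ≤
          Real.exp 1 * (l₀ + 1) * (4 * Real.exp l₀ * (vol * Δ K)) * Real.log (2 / (4 * Real.exp l₀ * (vol * Δ K))) /
            (l₀ * Real.log (Real.log (2 / (4 * Real.exp l₀ * (vol * Δ K))))) := by
  obtain ⟨E, hE, -⟩ := DirectPairingApexAnalyticScheme.expectAt_rate_of_king_analytic_log S hβ hm h1 os hl₀ hΔ hU5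
  refine ⟨E, hE, fun K hpos hhalf hsmall => ?_⟩
  -- abbreviations
  set Φ : ℕ → ℂ → ℂ := fun K z =>
    complexMGF (T4GenFunBounds.prodObs S K os) (T4GenFunBounds.gibbsMeasure (S.P K) (S.β K)) z with hΦ
  set η : ℝ := 4 * Real.exp l₀ * (vol * Δ K) with hηdef
  have hη0 : 0 < η := by positivity
  have hZpos : ∀ K t, 0 < T4GenFunBounds.schemeZ S os K t := fun K t =>
    T4GenFunBounds.dressedZ_pos (S.P K) (hβ K) (T4GenFunBounds.measurable_prodObs S hm K os)
      (T4GenFunBounds.abs_prodObs_le_one S h1 K os) t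
  -- the pair bound, for every `n`
  have hpair : ∀ n, |S.expectAt (K₀ + (K + n)) os - S.expectAt (K₀ + K) os| ≤
      Real.exp 1 * (l₀ + 1) * η * Real.log (2 / η) / (l₀ * Real.log (Real.log (2 / η))) := by
    intro n
    set D : ℂ → ℂ := fun z => Φ (K₀ + (K + n)) z - Φ (K₀ + K) z with hD
    have hDd : Differentiable ℂ D :=
      (T4GenFunBounds.differentiable_complexMGF_scheme S hβ hm h1 _ os).sub
        (T4GenFunBounds.differentiable_complexMGF_scheme S hβ hm h1 _ os)
    have hA : ∀ w : ℂ, ‖D w‖ ≤ 2 * Real.exp ‖w‖ := fun w =>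
      (norm_sub_le _ _).trans (by
        linarith [T4GenFunBounds.norm_complexMGF_scheme_le S hβ h1 (K₀ + (K + n)) os w,
          T4GenFunBounds.norm_complexMGF_scheme_le S hβ h1 (K₀ + K) os w])
    have hηb : ∀ t : ℝ, |t| ≤ l₀ → ‖D t‖ ≤ η := by
      intro t ht
      have e : D t = (((T4GenFunBounds.schemeZ S os (K₀ + (K + n)) t / T4GenFunBounds.schemeZ S os (K₀ + (K + n)) 0) -
          (T4GenFunBounds.schemeZ S os (K₀ + K) t / T4GenFunBounds.schemeZ S os (K₀ + K) 0) : ℝ) : ℂ) := by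
        rw [hD]
        simp only [hΦ]
        rw [T4GenFunBounds.complexMGF_scheme_ofReal S hβ, T4GenFunBounds.complexMGF_scheme_ofReal S hβ, Complex.ofReal_sub]
      rw [e, Complex.norm_real, Real.norm_eq_abs]
      -- `q′ = Z′(t)∕Z′(0)`, `q = Z(t)∕Z(0)`: both in `[e^{−∣t∣}, e^{∣t∣}]`, and `log q′ − log q = ΔgenFun` is `2volΔ`-small
      set q' := T4GenFunBounds.schemeZ S os (K₀ + (K + n)) t / T4GenFunBounds.schemeZ S os (K₀ + (K + n)) 0 with hq'
      set q := T4GenFunBounds.schemeZ S os (K₀ + K) t / T4GenFunBounds.schemeZ S os (K₀ + K) 0 with hq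
      have hqI := T4GenFunBounds.schemeZ_div_mem_Icc S hβ hm h1 (K₀ + K) os t
      have hq'I := T4GenFunBounds.schemeZ_div_mem_Icc S hβ hm h1 (K₀ + (K + n)) os t
      rw [← hq] at hqI
      rw [← hq'] at hq'I
      have hqpos : 0 < q := lt_of_lt_of_le (Real.exp_pos _) hqI.1
      have hq'pos : 0 < q' := lt_of_lt_of_le (Real.exp_pos _) hq'I.1
      have hqle : q ≤ Real.exp l₀ := hqI.2.trans (Real.exp_le_exp.mpr ht)
      -- the socket ⇒ `∣log q′ − log q∣ ≤ 2 vol Δ_K`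
      have hgen : |Real.log q' - Real.log q| ≤ 2 * (vol * Δ K) := by
        have h := abs_genFun_add_sub_le (Z := fun K => T4GenFunBounds.schemeZ S os (K₀ + K)) hU5 hl₀.le K n ht
        simp only [genFun] at h
        rw [hq', hq, Real.log_div (hZpos _ _).ne' (hZpos _ _).ne', Real.log_div (hZpos _ _).ne' (hZpos _ _).ne']
        simpa only [add_assoc] using h
      have hrat : q' - q = q * (Real.exp (Real.log q' - Real.log q) - 1) := by
        rw [Real.exp_sub, Real.exp_log hq'pos, Real.exp_log hqpos, mul_sub, mul_one, mul_div_assoc', mul_div_cancel_left₀ _ hqpos.ne']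
      have hexp : |Real.exp (Real.log q' - Real.log q) - 1| ≤ 2 * |Real.log q' - Real.log q| :=
        Real.abs_exp_sub_one_le (hgen.trans hhalf)
      rw [hrat, abs_mul, abs_of_pos hqpos, hηdef]
      calc q * |Real.exp (Real.log q' - Real.log q) - 1| ≤ Real.exp l₀ * (2 * (2 * (vol * Δ K))) :=
            mul_le_mul hqle (hexp.trans (by linarith)) (abs_nonneg _) (Real.exp_pos _).le
        _ = 4 * Real.exp l₀ * (vol * Δ K) := by ring
    have hsmall' : Real.exp (Real.exp 1) * η ≤ 2 := by rw [hηdef]; exact hsmall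
    have key := norm_deriv_le_loglog hDd hA hηb hl₀ hη0 hsmall'
    have hD0 : deriv D 0 = ((S.expectAt (K₀ + (K + n)) os - S.expectAt (K₀ + K) os : ℝ) : ℂ) := by
      have hd : HasDerivAt D (((S.expectAt (K₀ + (K + n)) os : ℝ) : ℂ) - ((S.expectAt (K₀ + K) os : ℝ) : ℂ)) 0 := by
        have ha := ((T4GenFunBounds.differentiable_complexMGF_scheme S hβ hm h1 (K₀ + (K + n)) os) 0).hasDerivAt
        have hb := ((T4GenFunBounds.differentiable_complexMGF_scheme S hβ hm h1 (K₀ + K) os) 0).hasDerivAt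
        rw [T4GenFunBounds.deriv_complexMGF_scheme_zero S hβ hm h1] at ha hb
        exact ha.sub hb
      rw [Complex.ofReal_sub]
      exact hd.deriv
    rw [hD0, Complex.norm_real, Real.norm_eq_abs] at key
    exact key
  have hE' : Tendsto (fun K => S.expectAt (K₀ + K) os) atTop (𝓝 E) :=
    ((tendsto_add_atTop_iff_nat K₀).2 hE).congr fun K => by rw [add_comm]
  exact limit_le_of_pairBound' (e := fun K => S.expectAt (K₀ + K) os) (fun n => by
    simpa only [add_assoc] using hpair n) hE' 

end Scheme

end Summit.QuantumFields.BalabanUV.T4Continuum.NE9.DirectPairingApexCGFRate
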